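import Summits.BirchSwinnertonDyer.BirchSwinnertonDyer.Theorems.SignedBaseChangeAnticyclotomicEisensteinDivisibilityAdmdefSignedControl
import HarnessLib

/-!
# Line `admdef` (crux `AnticyclotomicEisensteinDivisibility`, stmt-BirchSwinnertonDyer-20727), rigidity road: the RANK-ONE DICTIONARY —
# CHKLL25's bottom signed Selmer group `Sel^ε_1(K_0, E[p])` IS the classical `p`-Selmer group `Sel_p(E/K) ⊆ H¹(K, E[p])` under the transport `T`,
# and Howard's criterion at the root mod `𝔪` with the rank-one hypothesis in CLASSICAL currency

LEAD seat bsd-line-sbc-p1 (gen 29), `--supports stmt-BirchSwinnertonDyer-20727` (helper; OFF the v23 composition path).  The assembly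
`…AdmdefSignedControl.limitBaseClass_layer_zero_one_ne_zero_of_hasUnitLambda_of_lemma37_local` (this seat) carries the rank-one hypothesis in
CHKLL25's currency: «`signedOrdSelmerTorsion (W⁄K) p κ ε 1 0 1 = Sel^ε_1(K_0, E[p])` is a line `ℤ·s`, `s ≠ 0`».  THIS FILE translates it.
* §1 `mem_signedOrdSelmerTorsion_one_iff` — at `m = 1` the «ordinary» block of `Sel^ε_m(K_n, E[p^j])` is EMPTY (no prime divides `1`): the group is
  cut out by the signed condition at `v ∣ p` and «unramified at every `𝔓`» at every finite `v ∤ p` (proved, pure bookkeeping).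
* §2 `resH1Hom_layerZero_mem_signedOrdSelmerTorsion_one_iff_mem_selmerGroup` — **THE DICTIONARY**: for `X ∈ H¹(K, E[p])`,
  `T X ∈ Sel^ε_1(K_0, E[p]) ⟺ X ∈ Sel_p(E/K)` (`WeierstrassCurve.selmerGroup (W⁄K) p`: Kummer at every finite and infinite place), place by place:
  at `v ∣ p` the `±` control (`…SignedControl.ctrl_iff_of_lemma37_local`: the named print fact HLV 2022 Lemma 3.7 local form + the proved easy half);
  at good `v ∤ p` «unramified = Kummer» (Gross (7.1), `…LayerZeroDictionary`, PROVED in the tree); at the infinite places nothing (`K` imaginary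
  quadratic, `H¹(ℂ, ·) = 0`); at the BAD places `v ∤ p` the identity «unramified at every `𝔓 ∣ v` = Kummer at `v`» is the HYPOTHESIS (KU) — it is
  the layer-`0` content of CHKLL25's ∕ BCK21's CHOICE of unramified conditions at `ℓ ∣ N⁺` (flag `away-p-unr` of the carrier file) and holds when
  `p ∤ c_v·#Φ_v(k̄_v)` (e.g. on the line's all-ramified cell for `p ≥ 5`: `E[p]` ramified at a multiplicative `v` forces `p ∤ ord_v(Δ)`, additive `v`
  has `#Φ_v ≤ 4`); it is NOT proved here (the tree proves the good-reduction case only; Milne I.3.8 in Tamagawa form gives `⊆` under `p ∤ c_v`).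
* §3 `signedOrdSelmer_line_of_selmerGroup_line` — `T` is a bijection `H¹(K, E[p]) → H¹(Γ_{K_0}, E[p])` (onto: `…LayerZeroDictionary`; injective:
  `…CoreRootOfSeenAnchor`), so «`Sel_p(E/K) = ℤ·s`, `s ≠ 0`» gives «`Sel^ε_1(K_0, E[p]) = ℤ·T s`, `T s ≠ 0`».
* §4 `limitBaseClass_layer_zero_one_ne_zero_of_hasUnitLambda_of_selmerGroup_line` — **Howard's criterion at the root mod `𝔪` on the all-ramified cell
  with the rank-one hypothesis CLASSICAL**: [NV] `B.HasUnitLambda N` + `AcSigned.Setting` + {HLV 2022 Lemma 3.7 local (named fact)} + (KU) at the bad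
  places + `(N, d_K) = 1` + binder (ii) «`E[p]` ramified at every `q ∣ N`» + «`Sel_p(E/K) ⊆ H¹(K, E[p])` is a line» ⟹ `z_{0,1} ≠ 0`.

HONEST FRAMING: theorems only (no definition, no named fact, no `sorry`); the named fact and (KU) are HYPOTHESES; nothing about the crux, the
anchors (K1) or BSD is asserted; no summit statement is proved.

References: [cite: CastellaEtAl2025, §7.2, Thm. 7.4, Thm. 7.5 (arXiv:2308.10474v2 pp. 29–31)] [cite: BurungaleCastellaKim2021, arXiv:1908.09512 §7 (Sel_{N⁻m})]
[cite: Howard2006, Thm. 3.2.3 (c)] [cite: HatleyLeiVigni2022, Lemma 3.7 (proof)] [cite: GrossLMS1991, §7 (7.1)] [cite: MilneADT2006, Ch. I Prop. 3.8]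
[cite: SerreGaloisCohomology1997, I §2.4].
-/

-- D-0017: single-problem summit, the namespace repeats the problem name by design.
set_option linter.dupNamespace false
set_option autoImplicit false

noncomputable section

open scoped Classical NumberField Pointwise

namespace Summit.BirchSwinnertonDyer.BirchSwinnertonDyer.Theorems.SignedBaseChangeAcDivAdmdefRankOneDictionary

open WeierstrassCurve NumberField IsDedekindDomain Field
open Literature.NumberTheory.EllipticCurves Literature.NumberTheory.GaloisRepresentations
open Literature.NumberTheory.EllipticCurves.CastellaHsuKunduLeeLiu2025
open Literature.NumberTheory.EllipticCurves.BertoliniDarmon2005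
open Literature.NumberTheory.EllipticCurves.AcSigned
open Summit.BirchSwinnertonDyer.BirchSwinnertonDyer.Theorems.AdditiveKoly
open Summit.BirchSwinnertonDyer.BirchSwinnertonDyer.Theorems.SignedBaseChangeAcDivAdmdefCoreRootOfSeenAnchor
open Summit.BirchSwinnertonDyer.BirchSwinnertonDyer.Theorems.SignedBaseChangeAcDivAdmdefRootZero
open Summit.BirchSwinnertonDyer.BirchSwinnertonDyer.Theorems.SignedBaseChangeAcDivAdmdefLayerZeroDictionary
open Summit.BirchSwinnertonDyer.BirchSwinnertonDyer.Theorems.SignedBaseChangeAcDivAdmdefSignedControlEasy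
open Summit.BirchSwinnertonDyer.BirchSwinnertonDyer.Theorems.SignedBaseChangeAcDivAdmdefSignedControl

universe u

/-! ## §1 `Sel^ε_1(K_n, E[p^j])`: no ordinary block at `m = 1` -/

section LevelOne

variable {K : Type u} [Field K] [NumberField K] (W : WeierstrassCurve K) (p : ℕ) [Fact p.Prime] (κ : ZpExtension K p)

/-- **At `m = 1` the `N⁻m`-ordinary signed Selmer group has NO ordinary condition** (no prime `ℓ` divides `1`): `c ∈ Sel^ε_1(K_n, E[p^j])` iff
`c` satisfies the signed condition at every `v ∣ p` and is unramified at every prime `𝔓` of `K̄` above every finite `v ∤ p`.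
[cite: CastellaEtAl2025, §7.2 (arXiv:2308.10474v2 p0030 L16–L27)] -/
theorem mem_signedOrdSelmerTorsion_one_iff (ε : ℤˣ) (n j : ℕ) (c : W.torsionH1Over ((p : ℤ) ^ j) (κ.layerSubgroup n)) :
    c ∈ signedOrdSelmerTorsion W p κ ε 1 n j ↔
      (∀ v : HeightOneSpectrum (𝓞 K), ((p : ℕ) : 𝓞 K) ∈ v.asIdeal → c ∈ condAboveTorsion W p κ v (.sgn ε) n j) ∧
      (∀ v : HeightOneSpectrum (𝓞 K), ((p : ℕ) : 𝓞 K) ∉ v.asIdeal →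
        ∀ 𝔓 ∈ v.primesAbove, c ∈ unramifiedAt W ((p : ℤ) ^ j) (κ.layerSubgroup n) 𝔓) := by
  have hno : ∀ v : HeightOneSpectrum (𝓞 K), ¬ ∃ ℓ : ℕ, ℓ.Prime ∧ ℓ ∣ 1 ∧ ((ℓ : ℕ) : 𝓞 K) ∈ v.asIdeal := by
    rintro v ⟨ℓ, hℓ, hℓ1, -⟩
    exact hℓ.ne_one (Nat.dvd_one.mp hℓ1)
  rw [mem_signedOrdSelmerTorsion_iff]
  constructor
  · rintro ⟨hp, -, hunr⟩
    exact ⟨hp, fun v hv 𝔓 h𝔓 ↦ hunr v hv (hno v) 𝔓 h𝔓⟩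
  · rintro ⟨hp, hunr⟩
    exact ⟨hp, fun v _ h ↦ (hno v h).elim, fun v hv _ 𝔓 h𝔓 ↦ hunr v hv 𝔓 h𝔓⟩

end LevelOne

/-! ## §2 The dictionary `Sel^ε_1(K_0, E[p]) = T(Sel_p(E/K))` -/

section Dictionary

variable {K : Type} [Field K] [NumberField K] (W : WeierstrassCurve ℚ) [W.IsElliptic] [W.IsGloballyMinimal] {p : ℕ} [Fact p.Prime]
  (κ : ZpExtension K p) {𝔭 𝔭' : HeightOneSpectrum (𝓞 K)}

/-- **THE RANK-ONE DICTIONARY.**  Under the `Setting`, (Heeg) for `N_E`, the named print fact {HLV 2022 Lemma 3.7, local form} and the bad-place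
hypothesis (KU) «at every bad `v ∤ p`: unramified at every `𝔓 ∣ v` ⟺ Kummer at `v`», a class `X ∈ H¹(K, E[p])` has `T X ∈ Sel^ε_1(K_0, E[p])`
(CHKLL25's bottom signed Selmer group `signedOrdSelmerTorsion (W⁄K) p κ ε 1 0 1`) IFF `X ∈ Sel_p(E/K)` (the classical `p`-Selmer group
`selmerGroup (W⁄K) p`: Kummer at every finite and infinite place).  Place by place: `v ∣ p` — the `±` control (`ctrl_iff_of_lemma37_local`); good
`v ∤ p` — Gross (7.1) (`…LayerZeroDictionary.resH1Hom_layerZero_mem_unramifiedAt_iff_mem_selmerLocalKer`); bad `v ∤ p` — (KU); infinite — `K` is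
imaginary quadratic (`mem_selmerLocalKer_infinitePlace_of_isImaginaryQuadratic`).
[cite: CastellaEtAl2025, §7.2 (arXiv:2308.10474v2 p0030 L16–L27)] [cite: HatleyLeiVigni2022, Lemma 3.7 (proof)] [cite: GrossLMS1991, §7 (7.1)] -/
theorem resH1Hom_layerZero_mem_signedOrdSelmerTorsion_one_iff_mem_selmerGroup (hS : Setting W K p κ 𝔭 𝔭')
    (hH : SatisfiesHeegnerHypothesis (W.conductorNorm ℤ) K) (hloc : hatleyLeiVigni2022_lemma37_local_signedCondition_eq_kummer W K p κ 𝔭 𝔭')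
    (hbad : ∀ v : HeightOneSpectrum (𝓞 K), ¬ (W.baseChange K).HasGoodReductionAt v → ((p : ℕ) : 𝓞 K) ∉ v.asIdeal → ∀ X : Vp W K p,
      (∀ 𝔓 ∈ v.primesAbove, X ∈ unramifiedKer (geomTorsion (W.baseChange K) ((p ^ 1 : ℕ) : ℤ)) 𝔓) ↔
        X ∈ selmerLocalKer (W.baseChange K) (v.adicCompletion K) ((p ^ 1 : ℕ) : ℤ))
    (ε : ℤˣ) (X : Vp W K p) :
    resH1Hom (Literature.NumberTheory.EllipticCurves.subgroupIncl (κ.layerSubgroup 0))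
        (AddSubgroup.inclusion (geomTorsion_natCast_pow_one W (K := K) (p := p)).le) (fun _ _ ↦ rfl) X ∈
        signedOrdSelmerTorsion (W.baseChange K) p κ ε 1 0 1 ↔
      X ∈ selmerGroup (W.baseChange K) ((p ^ 1 : ℕ) : ℤ) := by
  have hp1 : ∀ v : HeightOneSpectrum (𝓞 K), ((p : ℕ) : 𝓞 K) ∉ v.asIdeal → ((((p ^ 1 : ℕ) : ℤ)) : 𝓞 K) ∉ v.asIdeal := by
    intro v hv; rw [Int.cast_natCast, Nat.pow_one]; exact hv
  rw [mem_signedOrdSelmerTorsion_one_iff, mem_selmerGroup_iff]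
  constructor
  · rintro ⟨habove, hunr⟩
    refine ⟨fun v ↦ ?_, fun w ↦ mem_selmerLocalKer_infinitePlace_of_isImaginaryQuadratic hS.isImaginaryQuadratic _ w X⟩
    by_cases hv : ((p : ℕ) : 𝓞 K) ∈ v.asIdeal
    · exact ctrl_of_lemma37_local W κ hS hH hloc ε v hv X (habove v hv)
    · by_cases hgood : (W.baseChange K).HasGoodReductionAt v
      · obtain ⟨𝔓, h𝔓⟩ := HeightOneSpectrum.primesAbove_nonempty v
        exact (resH1Hom_layerZero_mem_unramifiedAt_iff_mem_selmerLocalKer W κ hgood hv h𝔓 X).mp (hunr v hv 𝔓 h𝔓)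
      · exact (hbad v hgood hv X).mp fun 𝔓 h𝔓 ↦
          (resH1Hom_layerZero_mem_unramifiedAt_iff W κ 𝔓 X).mp (hunr v hv 𝔓 h𝔓)
  · rintro ⟨hfin, -⟩
    refine ⟨fun v hv ↦ resH1Hom_layerZero_mem_condAboveTorsion_of_mem_selmerLocalKer W κ v ε X (hfin v), fun v hv 𝔓 h𝔓 ↦ ?_⟩
    by_cases hgood : (W.baseChange K).HasGoodReductionAt v
    · exact (resH1Hom_layerZero_mem_unramifiedAt_iff_mem_selmerLocalKer W κ hgood hv h𝔓 X).mpr (hfin v)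
    · exact (resH1Hom_layerZero_mem_unramifiedAt_iff W κ 𝔓 X).mpr (((hbad v hgood hv X).mpr (hfin v)) 𝔓 h𝔓)

/-! ## §3 A classical Selmer LINE gives a signed Selmer LINE -/

/-- **Line ⟹ line.**  `T : H¹(K, E[p]) → H¹(Γ_{K_0}, E[p])` is injective (`…CoreRootOfSeenAnchor.res_layerZero_ne_zero`) and onto
(`…LayerZeroDictionary.exists_resH1Hom_layerZero_eq`), so by the dictionary: if `Sel_p(E/K) = ℤ·s` with `s ≠ 0`, then `Sel^ε_1(K_0, E[p]) = ℤ·T s`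
with `T s ≠ 0` — the three rank-one hypotheses (`hs`, `hs0`, `hline`) of `…SignedControl.limitBaseClass_layer_zero_one_ne_zero_of_hasUnitLambda_of_
lemma37_local` in CLASSICAL currency. [cite: CastellaEtAl2025, Thm. 7.5 (arXiv:2308.10474v2 p0031)] [cite: SerreGaloisCohomology1997, I §2.4] -/
theorem signedOrdSelmer_line_of_selmerGroup_line (hS : Setting W K p κ 𝔭 𝔭')
    (hH : SatisfiesHeegnerHypothesis (W.conductorNorm ℤ) K) (hloc : hatleyLeiVigni2022_lemma37_local_signedCondition_eq_kummer W K p κ 𝔭 𝔭')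
    (hbad : ∀ v : HeightOneSpectrum (𝓞 K), ¬ (W.baseChange K).HasGoodReductionAt v → ((p : ℕ) : 𝓞 K) ∉ v.asIdeal → ∀ X : Vp W K p,
      (∀ 𝔓 ∈ v.primesAbove, X ∈ unramifiedKer (geomTorsion (W.baseChange K) ((p ^ 1 : ℕ) : ℤ)) 𝔓) ↔
        X ∈ selmerLocalKer (W.baseChange K) (v.adicCompletion K) ((p ^ 1 : ℕ) : ℤ))
    (ε : ℤˣ) {s : Vp W K p} (hs : s ∈ selmerGroup (W.baseChange K) ((p ^ 1 : ℕ) : ℤ)) (hs0 : s ≠ 0)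
    (hline : ∀ c ∈ selmerGroup (W.baseChange K) ((p ^ 1 : ℕ) : ℤ), ∃ a : ℤ, c = a • s) :
    resH1Hom (Literature.NumberTheory.EllipticCurves.subgroupIncl (κ.layerSubgroup 0))
        (AddSubgroup.inclusion (geomTorsion_natCast_pow_one W (K := K) (p := p)).le) (fun _ _ ↦ rfl) s ∈
        signedOrdSelmerTorsion (W.baseChange K) p κ ε 1 0 1 ∧
      resH1Hom (Literature.NumberTheory.EllipticCurves.subgroupIncl (κ.layerSubgroup 0))
        (AddSubgroup.inclusion (geomTorsion_natCast_pow_one W (K := K) (p := p)).le) (fun _ _ ↦ rfl) s ≠ 0 ∧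
      ∀ c ∈ signedOrdSelmerTorsion (W.baseChange K) p κ ε 1 0 1, ∃ a : ℤ,
        c = a • resH1Hom (Literature.NumberTheory.EllipticCurves.subgroupIncl (κ.layerSubgroup 0))
          (AddSubgroup.inclusion (geomTorsion_natCast_pow_one W (K := K) (p := p)).le) (fun _ _ ↦ rfl) s := by
  refine ⟨(resH1Hom_layerZero_mem_signedOrdSelmerTorsion_one_iff_mem_selmerGroup W κ hS hH hloc hbad ε s).mpr hs,
    res_layerZero_ne_zero W κ hs0, fun c hc ↦ ?_⟩
  obtain ⟨X, rfl⟩ := exists_resH1Hom_layerZero_eq W κ c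
  obtain ⟨a, rfl⟩ := hline X
    ((resH1Hom_layerZero_mem_signedOrdSelmerTorsion_one_iff_mem_selmerGroup W κ hS hH hloc hbad ε X).mp hc)
  exact ⟨a, map_zsmul _ a s⟩

end Dictionary

/-! ## §4 Howard's criterion at the root mod `𝔪` on the all-ramified cell, rank one in CLASSICAL currency -/

section Assembly

variable {K : Type} [Field K] [NumberField K] {W : WeierstrassCurve ℚ} [W.IsElliptic] [W.IsGloballyMinimal] {p : ℕ} [Fact p.Prime]
  {κ : ZpExtension K p} {γ : absoluteGaloisGroup K} {N : ℕ} {ε : ℤˣ} {B : SignedBipartiteSystem W K p κ} {𝔭 𝔭' : HeightOneSpectrum (𝓞 K)}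

/-- **Howard's criterion at the root modulo `𝔪` on the all-ramified cell — rank one CLASSICAL.**  For a signed bipartite system `B` of sign `ε` at
level `N = N_E` with limit base class `z`, on the frame (`AcSigned.Setting`: `p` odd, good supersingular, `a_p = 0`, `K` imaginary quadratic, `p` split,
`κ` anticyclotomic, `p ∤ h_K`; `p ≥ 5`, `ρ̄_{E,p}` onto, every `ℓ ∣ N` split, `(N, d_K) = 1`), GIVEN the named print fact {HLV 2022 Lemma 3.7, local
form}, the bad-place identity (KU) «unramified at every `𝔓 ∣ v` = Kummer at `v`» at the bad `v ∤ p`, binder (ii) «`E[p]` ramified at every `q ∣ N`»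
and [NV] `B.HasUnitLambda N`: if the classical `p`-Selmer group `Sel_p(E/K) ⊆ H¹(K, E[p])` is a line `ℤ·s`, `s ≠ 0`, then **`z_{0,1} ≠ 0`**.
(`…SignedControl.limitBaseClass_layer_zero_one_ne_zero_of_hasUnitLambda_of_lemma37_local` ∘ `signedOrdSelmer_line_of_selmerGroup_line`.)
[cite: Howard2006, Thm. 3.2.3 (c)] [cite: CastellaEtAl2025, Thm. 7.1 (ii), Thm. 7.4, Thm. 7.5 (arXiv:2308.10474v2 pp. 29–31)]
[cite: HatleyLeiVigni2022, Lemma 3.7] [cite: BurungaleCastellaKim2021, arXiv:1908.09512 Prop. 7.4] -/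
theorem limitBaseClass_layer_zero_one_ne_zero_of_hasUnitLambda_of_selmerGroup_line (hB : IsSignedBipartiteSystem W K p κ γ N ε B)
    {z : Π n j : ℕ, (W.baseChange K).torsionH1Over ((p : ℤ) ^ j) (κ.layerSubgroup n)} (hz : B.IsLimitBaseClass z)
    (hS : Setting W K p κ 𝔭 𝔭') (hloc : hatleyLeiVigni2022_lemma37_local_signedCondition_eq_kummer W K p κ 𝔭 𝔭')
    (hbad : ∀ v : HeightOneSpectrum (𝓞 K), ¬ (W.baseChange K).HasGoodReductionAt v → ((p : ℕ) : 𝓞 K) ∉ v.asIdeal → ∀ X : Vp W K p,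
      (∀ 𝔓 ∈ v.primesAbove, X ∈ unramifiedKer (geomTorsion (W.baseChange K) ((p ^ 1 : ℕ) : ℤ)) 𝔓) ↔
        X ∈ selmerLocalKer (W.baseChange K) (v.adicCompletion K) ((p ^ 1 : ℕ) : ℤ))
    (hN : (N : ℤ) = W.conductorNorm ℤ) (h5 : 5 ≤ p) (hsurj : W.HasSurjectiveModNGaloisRep p)
    (hH : SatisfiesHeegnerHypothesis (W.conductorNorm ℤ) K) (hsp : ((Ideal.span {(p : ℤ)}).primesOver (𝓞 K)).ncard = 2)
    (hND : IsCoprime (N : ℤ) (NumberField.discr K))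
    (hall : ∀ q : ℕ, q.Prime → q ∣ N → ∃ v' : HeightOneSpectrum (𝓞 ℚ), ((q : ℕ) : 𝓞 ℚ) ∈ v'.asIdeal ∧
      ∃ 𝔓 ∈ v'.primesAbove, ∃ σ ∈ 𝔓.inertia (absoluteGaloisGroup ℚ), ∃ P : W.geomTorsion (p : ℤ), σ • P ≠ P)
    {s : Vp W K p} (hs : s ∈ selmerGroup (W.baseChange K) ((p ^ 1 : ℕ) : ℤ)) (hs0 : s ≠ 0)
    (hline : ∀ c ∈ selmerGroup (W.baseChange K) ((p ^ 1 : ℕ) : ℤ), ∃ a : ℤ, c = a • s)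
    (hNV : B.HasUnitLambda N) : z 0 1 ≠ 0 := by
  obtain ⟨hTs, hTs0, hTline⟩ := signedOrdSelmer_line_of_selmerGroup_line W κ hS hH hloc hbad ε hs hs0 hline
  exact limitBaseClass_layer_zero_one_ne_zero_of_hasUnitLambda_of_lemma37_local hB hz hS hloc hN h5 hsurj hH hsp hND hall hTs hTs0
    hTline hNV

end Assembly

end Summit.BirchSwinnertonDyer.BirchSwinnertonDyer.Theorems.SignedBaseChangeAcDivAdmdefRankOneDictionary

end
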